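import Summits.CriticalPhenomena.PercolationContinuityZ3.Theorems.Transplant.SkelFrmBChoiceDefs
import Summits.CriticalPhenomena.PercolationContinuityZ3.Theorems.Transplant.SkelFrmBParamsFineSize
import Summits.CriticalPhenomena.PercolationContinuityZ3.Theorems.Transplant.SkelNegBParamsSchedA
import HarnessLib

/-!
# N2 (frames-only node `SamePDropOfSkeletonFrm₁`, OPEN) params column over `PlanarSkeletonFrm` — (ζ″) ledger, part Sched-A AT THE STAGGERED CENTRE:
# the lattice record **`NegB.prFA : FinePrm`** (verbatim port of N1's `SkelNegBParamsSchedA` §2) and THE LINEAR COLUMN BOUND over the staggered cells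
# `fcellsS` — **`offNS x ≤ cOffS·(|x₀| + |x₁|) + 1`** (the (F) binder `hoff`), `hoffNS_at` (the (F) binder `hoffN`), `prFA_room` (`hL0/hL1`)

N1's part Sched-A (p3xxxxx) had two halves: §1 the column slot `offNA w := NrepA (cen w) + 1` and the schedule `schedOfA` — under (R-22) these are READ AT THE STAGGERED
CENTRE and live in `SkelFrmBChoiceDefs` as `NegB.offNS` / `NegB.schedOfS` (ruling (R-31)); §2 the lattice record `prFA` (skeleton arithmetic only — ported verbatim here)
and the linear column bound `offNA_le`, whose N1 proof used the EXACT representative at a cell centre (`rep₂ (cen x) = A·(x₀ n_L + x₁ v_L, x₀ h_L + x₁ v_β)`, `cen x`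
being a lattice point of the fine map).  A staggered centre `cenS x = cen x + (c₁ x₁, c₀ x₀)` is NOT a lattice point, so the bound is re-proved from the ROUNDING-ERROR
form `TwoAxis.Para.rep₂_err` (`2·|c₀c₁·rep₂ᵢ − A·(…)| ≤ c₀c₁`) and `|cenS x|ⱼ ≤ 20·r_j·(|x₀| + |x₁|)` (creep `≤ cmax ≤ r_j`): `NrepA (cenS x) ≤ A·(L̂₁ + L̂₀)·(|x₀| + |x₁|)
≤ 2·cOffA·(|x₀| + |x₁|)`, i.e. the N1 constant doubles (`cOffS := 2·cOffA`; the (F) files read the constant only through `hoff`/`hgapc`).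
* §1 `prFA`, `prFA_fields`, `prFA_ψ`, `prFA_D`, `prFA_c_pos`, `prFA_c_eq`, `prFA_room` (N1 verbatim over `Frm`/`DataNS`);
* §2 `abs_rep₂_le_of_abs_le` (generic rounding bound), `abs_cenS_le` (`|cenS x|ⱼ ≤ c_j·(|x₀|+|x₁|)`), **`NrepA_cenS_le`**, `cOffS`, **`offNS_le`** (`hoff`), **`hoffNS_at`** (`hoffN`).
builds on p205010 (kernel theorem, internal audit signed; external expert review pending) — nothing in this file uses p205010; NOTHING is claimed about the open node
`SamePDropOfSkeletonFrm₁` (`SamePDropOfSkeletonNeg₁` is CLOSED in the tree and untouched by this file).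
Lane `prim-bschramm`, seat `prim-bschramm-stmt` (gen 20); helper file (`--supports stmt-CriticalPhenomena-4575 --as helper`); ledger HOME/prim-bschramm-stmt/FRM-PARAMS.md (t9), (r13-17).
[cite: KozmaNitzan2024, §4 Lemma 10 Step IV (pp. 20–21): the fine steps; p. 26 ((29): columns)] [cite: MartineauTassion2017, §4.3]
-/

noncomputable section

open scoped Classical

namespace Summit.CriticalPhenomena.PercolationContinuityZ3.Theorems.Transplant

open Literature.Probability.Percolation Literature.Probability.LatticeModels SimpleGraph KNCells

namespace PlanarSkeletonFrm

namespace NegB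

open SkelConc (Consts)
open BoxProdZ2 (ConcRadiiG)
open Literature.Probability.Percolation.KozmaNitzan.Cells (oth)
open Neg

section Sched

variable (κ : Consts) {V : Type} [DecidableEq V] [Countable V] {G : SimpleGraph V} [G.LocallyFinite] (Φ : PlanarSkeletonFrm G) (t : V)
  (p : unitInterval) (D : Skelφ.StepI.DataNS V) (g f : ℕ) (c : Fin 2 → ℕ)

/-! ## §1 The lattice record of the (ζ′)/(ζ″) cells -/

/-- **THE LATTICE RECORD OF RECORD** `prFA := ⟨A, n_L, h_L, v_L, v_β, 20K·s₀, 20K·s₁, D_A⟩` (hp-8's `FinePrm`; `prFA.ψ φ′ t = NegB.fineA … φ′`). [this work] -/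
def prFA : Skelφ.FinePrm where
  A := Aof κ
  n := nL κ Φ t p D g f
  h := hL κ Φ t p D g f
  vα := vL κ Φ t p D g f
  vβ := vβL κ Φ t p D g f
  c₀ := 20 * ((fcellsA κ Φ t p D g f).K : ℤ) * (((fcellsA κ Φ t p D g f).s 0 : ℕ) : ℤ)
  c₁ := 20 * ((fcellsA κ Φ t p D g f).K : ℤ) * (((fcellsA κ Φ t p D g f).s 1 : ℕ) : ℤ)
  D := Skelφ.NegPrm.DofA (Aof κ) (nL κ Φ t p D g f) (hL κ Φ t p D g f) (ℓL κ Φ t p D g f) (vL κ Φ t p D g f)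

/-- The fields of `prFA` by `rfl`. [folklore] -/
theorem prFA_fields :
    (prFA κ Φ t p D g f).A = Aof κ ∧ (prFA κ Φ t p D g f).n = nL κ Φ t p D g f ∧ (prFA κ Φ t p D g f).h = hL κ Φ t p D g f ∧
      (prFA κ Φ t p D g f).vα = vL κ Φ t p D g f ∧ (prFA κ Φ t p D g f).vβ = vβL κ Φ t p D g f ∧
      (prFA κ Φ t p D g f).c₀ = 20 * ((fcellsA κ Φ t p D g f).K : ℤ) * (((fcellsA κ Φ t p D g f).s 0 : ℕ) : ℤ) ∧
      (prFA κ Φ t p D g f).c₁ = 20 * ((fcellsA κ Φ t p D g f).K : ℤ) * (((fcellsA κ Φ t p D g f).s 1 : ℕ) : ℤ) ∧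
      (prFA κ Φ t p D g f).D = Skelφ.NegPrm.DofA (Aof κ) (nL κ Φ t p D g f) (hL κ Φ t p D g f) (ℓL κ Φ t p D g f) (vL κ Φ t p D g f) :=
  ⟨rfl, rfl, rfl, rfl, rfl, rfl, rfl, rfl⟩

/-- **`prFA.ψ φ′ t = NegB.fineA … φ′`** (the (F) files' cell map IS the fine window map of record). [folklore] -/
theorem prFA_ψ (φ' : V → Site 2) : (prFA κ Φ t p D g f).ψ φ' t = fineA κ Φ t p D g f φ' := rfl

/-- `prFA.D = detD prFA.A prFA.n prFA.h prFA.vα prFA.vβ`. [folklore] -/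
theorem prFA_D : (prFA κ Φ t p D g f).D =
    TwoAxis.Para.detD (prFA κ Φ t p D g f).A (prFA κ Φ t p D g f).n (prFA κ Φ t p D g f).h (prFA κ Φ t p D g f).vα (prFA κ Φ t p D g f).vβ :=
  rfl

/-- `0 < prFA.c₀`, `0 < prFA.c₁`. [folklore] -/
theorem prFA_c_pos : 0 < (prFA κ Φ t p D g f).c₀ ∧ 0 < (prFA κ Φ t p D g f).c₁ := ⟨cA_pos κ Φ t p D g f 0, cA_pos κ Φ t p D g f 1⟩

/-- **THE UNIT IDENTITY AT THE RECORD**: `prFA.c₀ = A·s₀`, `prFA.c₁ = A·s₁`. [this work] -/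
theorem prFA_c_eq : (prFA κ Φ t p D g f).c₀ = (prFA κ Φ t p D g f).A * (((fcellsA κ Φ t p D g f).s 0 : ℕ) : ℤ) ∧
    (prFA κ Φ t p D g f).c₁ = (prFA κ Φ t p D g f).A * (((fcellsA κ Φ t p D g f).s 1 : ℕ) : ℤ) :=
  ⟨c_eq_A_mul_s κ Φ t p D g f 0, c_eq_A_mul_s κ Φ t p D g f 1⟩

/-- The fine resolutions are twenty units: `prFA.c_j = 20·r_j`. [folklore] -/
theorem prFA_c_eq_twenty_r (j : Fin 2) :
    (if j = 0 then (prFA κ Φ t p D g f).c₀ else (prFA κ Φ t p D g f).c₁) = 20 * (((fcellsA κ Φ t p D g f).r j : ℕ) : ℤ) := by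
  fin_cases j <;> simp [prFA, PCells2.r] <;> ring

/-- **The (F) binders `hL0/hL1` at the record** (`c₀·L 0 + 2 ≤ D_A`, `c₁·L 1 + 2 ≤ D_A`) from `room_fcellsA_at`. [folklore] -/
theorem prFA_room (hN : EqNumL κ Φ t p D g f) :
    (prFA κ Φ t p D g f).c₀ * (prFA κ Φ t p D g f).L 0 + 2 ≤ (prFA κ Φ t p D g f).D ∧ (prFA κ Φ t p D g f).c₁ * (prFA κ Φ t p D g f).L 1 + 2 ≤ (prFA κ Φ t p D g f).D := by
  obtain ⟨h0, h1⟩ := room_fcellsA_at κ Φ t p D g f hN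
  have e0 : (prFA κ Φ t p D g f).L 0 = |Aof κ| * (|vβL κ Φ t p D g f| + |vL κ Φ t p D g f|) := by
    unfold Skelφ.FinePrm.L Skelφ.FinePrm.lvGen
    simp only [if_true, Matrix.cons_val_zero, Matrix.cons_val_one]
    rw [add_comm]; rfl
  have e1 : (prFA κ Φ t p D g f).L 1 = |Aof κ| * (|(nL κ Φ t p D g f : ℤ)| + |hL κ Φ t p D g f|) := by
    unfold Skelφ.FinePrm.L Skelφ.FinePrm.lvGen
    simp only [show ((1 : Fin 2) = 0) = False from propext ⟨fun h => absurd h (by decide), False.elim⟩, if_false, Matrix.cons_val_zero, Matrix.cons_val_one]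
    rfl
  rw [e0, e1]
  exact ⟨h0, h1⟩

/-! ## §2 The linear column bound at the staggered centre -/

omit [DecidableEq V] [Countable V] [G.LocallyFinite] in
/-- **Rounding bound for the canonical representative**: if `|z₀| ≤ c₀·S` and `|z₁| ≤ c₁·S` then `|rep₂ z|₀ ≤ |A|·(|n| + |v_α|)·S` and `|rep₂ z|₁ ≤ |A|·(|h| + |v_β|)·S`
(from `rep₂_err`: the rounding error is at most half a unit). [folklore] -/
theorem abs_rep₂_le_of_abs_le {A n h vα vβ c₀ c₁ : ℤ} (hc₀ : 0 < c₀) (hc₁ : 0 < c₁) {z : Site 2} {S : ℤ}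
    (hz0 : |z 0| ≤ c₀ * S) (hz1 : |z 1| ≤ c₁ * S) :
    |TwoAxis.Para.rep₂ A n h vα vβ c₀ c₁ z 0| ≤ |A| * (|n| + |vα|) * S ∧ |TwoAxis.Para.rep₂ A n h vα vβ c₀ c₁ z 1| ≤ |A| * (|h| + |vβ|) * S := by
  have hc : 0 < c₀ * c₁ := mul_pos hc₀ hc₁
  obtain ⟨e0, e1⟩ := TwoAxis.Para.rep₂_err (A := A) (n := n) (h := h) (vα := vα) (vβ := vβ) hc z
  have hA := abs_nonneg A
  -- the two exact parts are bounded by `c₀c₁·|A|·(…)·S`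
  have b0 : |A * (z 0 * n * c₁ + z 1 * vα * c₀)| ≤ (c₀ * c₁) * (|A| * (|n| + |vα|) * S) := by
    have h1 : |z 0 * n * c₁ + z 1 * vα * c₀| ≤ (|n| * c₁) * |z 0| + (|vα| * c₀) * |z 1| := by
      calc |z 0 * n * c₁ + z 1 * vα * c₀| ≤ |z 0 * n * c₁| + |z 1 * vα * c₀| := abs_add_le _ _
        _ = (|n| * c₁) * |z 0| + (|vα| * c₀) * |z 1| := by
            rw [abs_mul, abs_mul, abs_mul, abs_mul, abs_of_pos hc₀, abs_of_pos hc₁]; ring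
    have h2 : (|n| * c₁) * |z 0| ≤ (|n| * c₁) * (c₀ * S) := mul_le_mul_of_nonneg_left hz0 (by positivity)
    have h3 : (|vα| * c₀) * |z 1| ≤ (|vα| * c₀) * (c₁ * S) := mul_le_mul_of_nonneg_left hz1 (by positivity)
    rw [abs_mul]
    have h4 := mul_le_mul_of_nonneg_left (h1.trans (add_le_add h2 h3)) hA
    have e : |A| * ((|n| * c₁) * (c₀ * S) + (|vα| * c₀) * (c₁ * S)) = (c₀ * c₁) * (|A| * (|n| + |vα|) * S) := by ring
    linarith
  have b1 : |A * (z 0 * h * c₁ + z 1 * vβ * c₀)| ≤ (c₀ * c₁) * (|A| * (|h| + |vβ|) * S) := by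
    have h1 : |z 0 * h * c₁ + z 1 * vβ * c₀| ≤ (|h| * c₁) * |z 0| + (|vβ| * c₀) * |z 1| := by
      calc |z 0 * h * c₁ + z 1 * vβ * c₀| ≤ |z 0 * h * c₁| + |z 1 * vβ * c₀| := abs_add_le _ _
        _ = (|h| * c₁) * |z 0| + (|vβ| * c₀) * |z 1| := by
            rw [abs_mul, abs_mul, abs_mul, abs_mul, abs_of_pos hc₀, abs_of_pos hc₁]; ring
    have h2 : (|h| * c₁) * |z 0| ≤ (|h| * c₁) * (c₀ * S) := mul_le_mul_of_nonneg_left hz0 (by positivity)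
    have h3 : (|vβ| * c₀) * |z 1| ≤ (|vβ| * c₀) * (c₁ * S) := mul_le_mul_of_nonneg_left hz1 (by positivity)
    rw [abs_mul]
    have h4 := mul_le_mul_of_nonneg_left (h1.trans (add_le_add h2 h3)) hA
    have e : |A| * ((|h| * c₁) * (c₀ * S) + (|vβ| * c₀) * (c₁ * S)) = (c₀ * c₁) * (|A| * (|h| + |vβ|) * S) := by ring
    linarith
  -- `c₀c₁·|R| ≤ |error| + |exact part|`, then divide by `c₀c₁`
  set R0 := TwoAxis.Para.rep₂ A n h vα vβ c₀ c₁ z 0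
  set R1 := TwoAxis.Para.rep₂ A n h vα vβ c₀ c₁ z 1
  have t0 := abs_sub_abs_le_abs_sub (c₀ * c₁ * R0) (A * (z 0 * n * c₁ + z 1 * vα * c₀))
  have t1 := abs_sub_abs_le_abs_sub (c₀ * c₁ * R1) (A * (z 0 * h * c₁ + z 1 * vβ * c₀))
  rw [abs_mul, abs_of_pos hc] at t0 t1
  have k0 : (c₀ * c₁) * (2 * |R0|) ≤ (c₀ * c₁) * (2 * (|A| * (|n| + |vα|) * S) + 1) := by nlinarith
  have k1 : (c₀ * c₁) * (2 * |R1|) ≤ (c₀ * c₁) * (2 * (|A| * (|h| + |vβ|) * S) + 1) := by nlinarith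
  have l0 := le_of_mul_le_mul_left k0 hc
  have l1 := le_of_mul_le_mul_left k1 hc
  constructor <;> omega

/-- **The staggered centre grows linearly**: `|cenS x|ⱼ ≤ 20·r_j·(|x₀| + |x₁|)` (the creep is `≤ cmax ≤ r_j`). [folklore] -/
theorem abs_cenS_le (x : Site 2) (j : Fin 2) :
    |(fcellsS κ Φ t p D g f c).cenS x j| ≤ 20 * (((fcellsA κ Φ t p D g f).r j : ℕ) : ℤ) * (|x 0| + |x 1|) := by
  set P := fcellsS κ Φ t p D g f c
  have key : ∀ a b ca r : ℤ, 0 ≤ r → 0 ≤ ca → ca ≤ r → |20 * r * a + ca * b| ≤ 20 * r * (|a| + |b|) := by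
    intro a b ca r hr hca hcr
    have h1 : |20 * r * a + ca * b| ≤ 20 * r * |a| + ca * |b| := by
      calc |20 * r * a + ca * b| ≤ |20 * r * a| + |ca * b| := abs_add_le _ _
        _ = 20 * r * |a| + ca * |b| := by
            rw [abs_mul, abs_mul, abs_mul, abs_of_nonneg hr, abs_of_nonneg hca, abs_of_nonneg (by norm_num : (0 : ℤ) ≤ 20)]
    nlinarith [abs_nonneg a, abs_nonneg b, mul_le_mul_of_nonneg_right hcr (abs_nonneg b)]
  have hr : ∀ k, (0 : ℤ) ≤ (((fcellsA κ Φ t p D g f).r k : ℕ) : ℤ) := fun k => by positivity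
  have hcr : ∀ i k, P.c i ≤ (((fcellsA κ Φ t p D g f).r k : ℕ) : ℤ) := fun i k => (P.hcm i).trans (by exact_mod_cast P.hcr k)
  rw [PCells2S.cenS_apply]
  fin_cases j
  · show |20 * (((fcellsA κ Φ t p D g f).r 0 : ℕ) : ℤ) * x 0 + P.c 1 * x 1| ≤ 20 * (((fcellsA κ Φ t p D g f).r 0 : ℕ) : ℤ) * (|x 0| + |x 1|)
    exact key (x 0) (x 1) (P.c 1) _ (hr 0) (P.hc0 1) (hcr 1 0)
  · show |20 * (((fcellsA κ Φ t p D g f).r 1 : ℕ) : ℤ) * x 1 + P.c 0 * x 0| ≤ 20 * (((fcellsA κ Φ t p D g f).r 1 : ℕ) : ℤ) * (|x 0| + |x 1|)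
    rw [add_comm (|x 0|)]
    exact key (x 1) (x 0) (P.c 0) _ (hr 1) (P.hc0 0) (hcr 0 1)

/-- **`NrepA (cenS x) ≤ A·(L̂₁ + L̂₀)·(|x₀| + |x₁|)`** (rounding bound + the linear growth of the staggered centre). [this work] -/
theorem NrepA_cenS_le (x : Site 2) :
    (NrepA κ Φ t p D g f ((fcellsS κ Φ t p D g f c).cenS x) : ℤ) ≤
      Aof κ * (Skelφ.NegPrm.L1hat (nL κ Φ t p D g f) (hL κ Φ t p D g f) +
        Skelφ.NegPrm.L0hat (nL κ Φ t p D g f) (hL κ Φ t p D g f) (ℓL κ Φ t p D g f) (vL κ Φ t p D g f)) * (|x 0| + |x 1|) := by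
  have hA : 0 < Aof κ := (Aof_pos κ).1
  have hz0 := abs_cenS_le κ Φ t p D g f c x 0
  have hz1 := abs_cenS_le κ Φ t p D g f c x 1
  have e0 : 20 * (((fcellsA κ Φ t p D g f).r 0 : ℕ) : ℤ) = 20 * ((fcellsA κ Φ t p D g f).K : ℤ) * (((fcellsA κ Φ t p D g f).s 0 : ℕ) : ℤ) := by
    simp [PCells2.r]; ring
  have e1 : 20 * (((fcellsA κ Φ t p D g f).r 1 : ℕ) : ℤ) = 20 * ((fcellsA κ Φ t p D g f).K : ℤ) * (((fcellsA κ Φ t p D g f).s 1 : ℕ) : ℤ) := by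
    simp [PCells2.r]; ring
  rw [e0] at hz0; rw [e1] at hz1
  obtain ⟨b0, b1⟩ := abs_rep₂_le_of_abs_le (A := Aof κ) (n := (nL κ Φ t p D g f : ℤ)) (h := hL κ Φ t p D g f) (vα := vL κ Φ t p D g f)
    (vβ := vβL κ Φ t p D g f) (cA_pos κ Φ t p D g f 0) (cA_pos κ Φ t p D g f 1) hz0 hz1
  unfold NrepA
  push_cast
  rw [abs_of_pos hA] at b0 b1
  unfold Skelφ.NegPrm.L1hat Skelφ.NegPrm.L0hat
  unfold vβL at b0 b1 ⊢
  have hn : |(nL κ Φ t p D g f : ℤ)| = nL κ Φ t p D g f := abs_of_nonneg (by positivity)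
  rw [hn] at b0
  have e : Aof κ * (((nL κ Φ t p D g f : ℤ) + |vL κ Φ t p D g f|)) * (|x 0| + |x 1|) +
      Aof κ * ((|hL κ Φ t p D g f| + |Skelφ.NegPrm.vβOf (nL κ Φ t p D g f) (hL κ Φ t p D g f) (ℓL κ Φ t p D g f) (vL κ Φ t p D g f)|)) * (|x 0| + |x 1|) =
      Aof κ * (((nL κ Φ t p D g f : ℤ) + |hL κ Φ t p D g f|) +
        (|Skelφ.NegPrm.vβOf (nL κ Φ t p D g f) (hL κ Φ t p D g f) (ℓL κ Φ t p D g f) (vL κ Φ t p D g f)| + |vL κ Φ t p D g f|)) * (|x 0| + |x 1|) := by ring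
  linarith

/-- **THE COLUMN CONSTANT OF RECORD OF THE N2 CHAIN** `cOffS := 2·cOffA = 2·A·(ℓ_L + 21·n_L + 1)` (`≥ A·(L̂₁ + L̂₀)`). [this work] -/
def cOffS : ℕ := 2 * (20 * Neg.K κ * (ℓL κ Φ t p D g f + 21 * nL κ Φ t p D g f + 1))

/-- `cOffS` as an integer: `2·A·(ℓ_L + 21 n_L + 1)`. [folklore] -/
theorem cOffS_int : (cOffS κ Φ t p D g f : ℤ) = 2 * (Aof κ * ((ℓL κ Φ t p D g f : ℤ) + 21 * nL κ Φ t p D g f + 1)) := by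
  unfold cOffS; rw [Aof_eq_K]; push_cast; ring

/-- **THE LINEAR COLUMN BOUND AT THE STAGGERED CENTRE (the (F) binder `hoff`)**: `offNS x ≤ cOffS·(|x₀| + |x₁|) + 1`, under the numeric long clause and
`|h_L| ≤ 10·n_L`, for EVERY creep value. [this work] -/
theorem offNS_le (hN : EqNumL κ Φ t p D g f) (hκ : (hL κ Φ t p D g f).natAbs ≤ 10 * nL κ Φ t p D g f) (x : Site 2) :
    offNS κ Φ t p D g f c x ≤ cOffS κ Φ t p D g f * ((x 0).natAbs + (x 1).natAbs) + 1 := by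
  have h := NrepA_cenS_le κ Φ t p D g f c x
  have hL0 := L0hat_le κ Φ t p D g f hN hκ
  have hL1 := L1hat_le κ Φ t p D g f hκ
  have hA : 0 < Aof κ := (Aof_pos κ).1
  have hℓ0 : (0 : ℤ) ≤ ℓL κ Φ t p D g f := by positivity
  have hn0 : (0 : ℤ) ≤ nL κ Φ t p D g f := by positivity
  have hx : (0 : ℤ) ≤ |x 0| + |x 1| := by positivity
  have hsum : Skelφ.NegPrm.L1hat (nL κ Φ t p D g f) (hL κ Φ t p D g f) +
      Skelφ.NegPrm.L0hat (nL κ Φ t p D g f) (hL κ Φ t p D g f) (ℓL κ Φ t p D g f) (vL κ Φ t p D g f) ≤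
      2 * ((ℓL κ Φ t p D g f : ℤ) + 21 * nL κ Φ t p D g f + 1) := by linarith
  have key : (NrepA κ Φ t p D g f ((fcellsS κ Φ t p D g f c).cenS x) : ℤ) ≤ 2 * (Aof κ * ((ℓL κ Φ t p D g f : ℤ) + 21 * nL κ Φ t p D g f + 1)) * (|x 0| + |x 1|) := by
    have s := mul_le_mul_of_nonneg_right (mul_le_mul_of_nonneg_left hsum hA.le) hx
    have e : Aof κ * (2 * ((ℓL κ Φ t p D g f : ℤ) + 21 * nL κ Φ t p D g f + 1)) * (|x 0| + |x 1|) =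
        2 * (Aof κ * ((ℓL κ Φ t p D g f : ℤ) + 21 * nL κ Φ t p D g f + 1)) * (|x 0| + |x 1|) := by ring
    linarith
  unfold offNS
  have : (NrepA κ Φ t p D g f ((fcellsS κ Φ t p D g f c).cenS x) : ℤ) ≤ ((cOffS κ Φ t p D g f * ((x 0).natAbs + (x 1).natAbs) : ℕ) : ℤ) := by
    push_cast; rw [cOffS_int]; exact key
  have := Int.ofNat_le.1 this
  omega

/-- **The (F) binder `hoffN` at the staggered centre**: `‖rep₂ prFA… (cenS x)‖₁ + 1 ≤ offNS x` (by definition of `offNS`). [folklore] -/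
theorem hoffNS_at (x : Site 2) :
    (TwoAxis.Para.rep₂ (prFA κ Φ t p D g f).A (prFA κ Φ t p D g f).n (prFA κ Φ t p D g f).h (prFA κ Φ t p D g f).vα (prFA κ Φ t p D g f).vβ (prFA κ Φ t p D g f).c₀
          (prFA κ Φ t p D g f).c₁ ((fcellsS κ Φ t p D g f c).cenS x) 0).natAbs +
        (TwoAxis.Para.rep₂ (prFA κ Φ t p D g f).A (prFA κ Φ t p D g f).n (prFA κ Φ t p D g f).h (prFA κ Φ t p D g f).vα (prFA κ Φ t p D g f).vβ (prFA κ Φ t p D g f).c₀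
          (prFA κ Φ t p D g f).c₁ ((fcellsS κ Φ t p D g f c).cenS x) 1).natAbs + 1 ≤ offNS κ Φ t p D g f c x :=
  le_rfl

end Sched

end NegB

end PlanarSkeletonFrm

end Summit.CriticalPhenomena.PercolationContinuityZ3.Theorems.Transplant

end
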